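import Summits.BirchSwinnertonDyer.BirchSwinnertonDyer.Theorems.PrintCFramBottomClassIndexLawFiveLeLevelDictionaryLocalInputs
import Summits.BirchSwinnertonDyer.BirchSwinnertonDyer.Theorems.PrintCFramBottomClassIndexLawFiveLeLevelDictionaryRationalEngines
import Summits.BirchSwinnertonDyer.BirchSwinnertonDyer.Theorems.PrintCFramBottomClassIndexLawFiveLeLevelDictionaryRationalLine
import Summits.BirchSwinnertonDyer.BirchSwinnertonDyer.Theorems.PrintCFramBottomClassIndexLawFiveLeLevelDictionaryPadic
import Summits.BirchSwinnertonDyer.BirchSwinnertonDyer.Theorems.PrintCFramBottomClassIndexLawFiveLeBernoulliUnitsOfKrizLiClass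
import Summits.BirchSwinnertonDyer.BirchSwinnertonDyer.Theorems.PrintCFramBottomClassIndexLawFiveLeBernoulliUnitsAvatars
import Summits.BirchSwinnertonDyer.BirchSwinnertonDyer.Theorems.PrintCFramBottomClassIndexLawFiveLeBernoulliUnitsLineCharacters
import Literature.NumberTheory.EllipticCurves.PointDivisibilityProofs
import Literature.NumberTheory.EllipticCurves.PAdicHeightsLogProofs
import Literature.NumberTheory.EllipticCurves.LocalTorsionCohomologyCoprime
import HarnessLib

/-!
# Route `PrintCFram`, crux C2 `BottomClassIndexLawFiveLe` (stmt-BirchSwinnertonDyer-20372), line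
# `eisenstein-resource-bdp-line` (registry v18): **THE LEVEL DICTIONARY (α), END TO END — `levelPos_imp_classFactor`**:
# on the CM-ramified class, a rational point of LEVEL ≥ 1 at `p` which is not `p`-divisible in `W(ℚ)` forces the CLASS
# FACTOR `B_{1,ψ⁻¹}` of the class's odd Kriz–Li character to be a NON-UNIT — Kriz–Li-free, Mazur–Wiles-free, `L`-value-free
# (cell `bsd-print-cfram`, width seat `bsd-line-cfram-p1-w6` g3; helper `--supports` 20372; 0 defs, 0 facts, 0 sorry)

HONEST FRAMING. Nothing about BSD is proved here and no stub of the line is closed; BSD is not proved by any of this. This is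
the structure theorem «B1 ⊇ {level ≥ 1}» of the LEAD g10 report §2(d)(α) / §4 bullet 1 (`levelPos_imp_classFactor`): the
members of the class which registry v18's research stub B1 `stub_bsdp_of_classFactor` must treat include every member whose
generator is `p`-divisible in `W(ℚ_p)` (the crux's own level binder `n ≥ 1`). Equivalently (contrapositive,
`level_eq_zero_of_unit_classFactor`): on the Kriz–Li locus (unit class factor) the crux's level binder is `n = 0` — by
descent alone, with no `p`-adic `L`-function, no Kriz–Li congruence and no Mazur–Wiles theorem.

PROOF (LEAD g10 report §2(d)(α), in the kernel). `P ∈ W(ℚ)`, `P ∉ pW(ℚ)`, `pQ = P` in `W(ℚ_p)`; `z = (σ ↦ σQ̃ − Q̃)` the Kummer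
cocycle of a `p`-th root `Q̃ ∈ W(ℚ̄)`. Its class is non-zero; it is locally trivial at `p` (level ≥ 1, w4 g8
`kummerClassTorsion_mem_torsionLocalKer_of_toPadicPoint_nsmul`) and at every bad `ℓ ≠ p` (`W(ℚ_ℓ)[p] = 0`, file 1
`forall_prime_nsmul_eq_zero_adicCompletion_of_bad`); the quotient `W[p]/Φ` of the rational line `Φ = W[𝔭]` has no
inertia-fixed vector at the bad places and at `p` (file 1). So (α-W) `LevelDictionary.unramified_quot_or_sub_of_kummer_line`
(w4 g8) produces an everywhere-unramified NON-ZERO class for `Φ.Quot` or for `Φ.Sub`. The characters of the two lines are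
`θ_S = b∘χ_m` and `θ_Q = χ̄_p·(b∘χ_m)⁻¹` with `a_q ≡ b(q) + q b(q)⁻¹` (T1 over `ℚ`, `exists_cyclotomicFactor_traceForm_of_isRationalLine`,
and the product rule `θ_S θ_Q = χ̄_p` from `exists_sqrt_rationalLine_scalars_of_cmRamified`), so by the uniqueness of the
Eisenstein pair (`EisensteinPair.eq_or_eq_of_traceForm_congr`, w3 g3) the Teichmüller lift `ψ₁` of `b` satisfies
`ψ↑ = ψ₁↑` or `ψ↑ = ψ₁⁻¹↑ω↑`. In either case one of `θ_S, θ_Q` has the ODD avatar `~ψ` and the other the EVEN avatar `~ψ⁻¹ω`,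
and a UNIT class factor `‖B_{1,ψ⁻¹}‖ = 1` feeds file 2's engines (`false_of_unramified_class_of_odd_avatar` /
`false_of_unramified_class_of_even_avatar` = w8 g2's `_unconditional` ODD/EVEN engines in `H¹`-currency): contradiction. Hence
`‖B_{1,ψ⁻¹}‖ < 1`, i.e. `≤ p⁻¹`.

* Inputs: file 1 `…LevelDictionaryLocalInputs` (class-side local inputs), file 2 `…LevelDictionaryRationalEngines` (the two
  engines in `H¹`-currency over `Γ_ℚ`), file 3 `…LevelDictionaryRationalLine` (`exists_rationalLineData_of_hss`: the rational
  line with both characters and their Dirichlet avatars), w4 g8's `…LevelDictionaryLine` / `…LevelDictionaryPadic`.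
* **`norm_bernoulliOnePrim_le_of_level_pos`** (= `levelPos_imp_classFactor`) and its readings in the crux's binder
  currency: `norm_bernoulliOnePrim_le_of_level_pos_of_generator` (for the generator of `W(ℚ)` modulo torsion) and
  **`level_eq_zero_of_unit_classFactor`** (unit class factor ⟹ the crux's level binder `n` is `0`); (append)
  `norm_bernoulliOnePrim_le_of_one_le_level` (the crux's binder `n ≥ 1` ⟹ B1's premise — the form LEAD g11 quotes).

THEOREMS ONLY; no definition, no named fact, no `sorry`. No summit statement is proved by this seat. References:
[SilvermanAEC2009] VIII.§2, X.§4; [Mazur1978] §5, Prop. 6.3 (1); [Washington1997] §5.1, §6.3, §10.2, Thm. 14.1;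
[KrizLi2019] §1.5, §7.1; [GreenbergLNM1716] §3; the LEAD g10 report §2(d), §4 (crux workfile
`Lines/eisenstein-resource-bdp-line-lead-g10.md`).
-/

set_option autoImplicit false
-- `…BirchSwinnertonDyer.BirchSwinnertonDyer.Theorems…` is the problem's mandated namespace (D-0017).
set_option linter.dupNamespace false

noncomputable section

open scoped Classical Pointwise

namespace Summit.BirchSwinnertonDyer.BirchSwinnertonDyer.Theorems.PrintCFram.LevelDictionaryAlpha

open NumberField IsDedekindDomain Field WeierstrassCurve DirichletCharacter
open Literature.NumberTheory.EllipticCurves Literature.NumberTheory.GaloisRepresentations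
  Literature.NumberTheory.EllipticCurves.Rank1Residual Literature.NumberTheory.EllipticCurves.KrizLi2019
  Literature.NumberTheory.EllipticCurves.GreenbergSelmer
open Summit.BirchSwinnertonDyer.Rank1Residual
open Summit.BirchSwinnertonDyer.BirchSwinnertonDyer.Theorems.PrintCFram.HerbrandSelmerToHom

variable {p : ℕ} [hp : Fact p.Prime]

/-! ## §2 The (α) consumer: LEVEL ≥ 1 ⟹ the class factor is a non-unit -/

section Consumer

variable (W : WeierstrassCurve ℚ) [W.IsElliptic] [W.IsGloballyMinimal] (p)

/-- **THE LEVEL DICTIONARY (α), END TO END (`levelPos_imp_classFactor`, LEAD g10 report §4).** Let `W/ℚ` be globally minimal with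
CM, `p ≥ 5` ramified in the CM field, `(f, ψ, ω)` a Kriz–Li character datum of `W` with `ψ` ODD (`ω` Teichmüller, `hss`; such data
exist class-wide, `KrizLiBinders.exists_krizLiBinders_of_cmRamified`, and `B_{1,ψ⁻¹}` does not depend on the choice,
`OffLocusDictionary.bernoulliPair_eq_of_hss`). Let `P ∈ W(ℚ)` be NOT `p`-divisible in `W(ℚ)` and of LEVEL ≥ 1 at `p`:
`p • Q = P` for some `Q ∈ W(ℚ_p)` (the crux's literal binder `∃ Q, p • Q = W.toPadicPoint p P`). Then the CLASS FACTOR is a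
non-unit: **`‖B_{1,ψ⁻¹}‖_p ≤ p⁻¹`** — the premise of registry v18's research stub B1 `stub_bsdp_of_classFactor`. No Kriz–Li
theorem, no Mazur–Wiles theorem, no `L`-value enters: Kummer theory of `P`, the (α-W) dichotomy, the two line characters with
their Dirichlet avatars, and the Herbrand–Stickelberger / Kummer-reflection engines (see the module docstring for the proof).
[cite: SilvermanAEC2009, VIII.§2 and X.§4] [cite: Washington1997, §6.3, §10.2 and Thm. 6.17]
[cite: KrizLi2019, §1.5 (p. 7) and §7.1 (p. 43)] [cite: GreenbergLNM1716, §3 (PDF p. 86)] -/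
theorem norm_bernoulliOnePrim_le_of_level_pos (hCM : W.HasCM) (hram : CMRamified W p) (h5 : 5 ≤ p)
    {f : ℕ} [NeZero f] (ψ : DirichletCharacter ℚ_[p] f) (ω : DirichletCharacter ℚ_[p] p)
    (hψ : ψ.Odd) (hω : IsTeichmullerCharacter ω)
    (hss : ∀ ℓ : ℕ, ℓ.Prime → ¬ (ℓ ∣ p * W.conductorNorm ℤ) →
      ‖((W.LFunction ℓ : ℤ) : ℚ_[p]) - (ψ (ℓ : ZMod f) + ψ⁻¹ (ℓ : ZMod f) * ω (ℓ : ZMod p))‖ < 1)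
    (P : W.toAffine.Point) (hP : ∀ R : W.toAffine.Point, (p : ℤ) • R ≠ P)
    (hlev : ∃ Q : (W.baseChange ℚ_[p]).toAffine.Point, p • Q = W.toPadicPoint p P) :
    ‖bernoulliOnePrim ψ⁻¹‖ ≤ (p : ℝ)⁻¹ := by
  have hpr : p.Prime := hp.out
  have hp2 : p ≠ 2 := by omega
  have hp0 : (p : ℤ) ≠ 0 := by exact_mod_cast hpr.ne_zero
  haveI hpne : NeZero p := ⟨hpr.ne_zero⟩
  have hωodd : ω.Odd := KrizLiBinders.teichmuller_apply_neg_one hp2 hω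
  -- `B_{1,ψ⁻¹}` is `p`-integral; suppose it is a unit
  have hne : ¬ ψ.Even := EisensteinPair.not_even_of_odd' ψ hψ
  obtain ⟨ha, -⟩ := BernoulliUnits.norm_bernoulliPair_le_one_of_hss W hCM hram h5 hω ψ hss
    (1 : DirichletCharacter ℚ_[p] 1) (fun h ↦ hpr.one_lt.ne' (Nat.dvd_one.mp h))
  rw [RegularLocusBernoulliPair.bernoulliOnePrim_bernoulliCharOne_of_not_even ψ _ hne] at ha
  by_contra hcls
  have hB1 : ‖bernoulliOnePrim ψ⁻¹‖ = 1 := by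
    by_contra h1
    exact hcls (norm_le_inv_of_norm_lt_one (lt_of_le_of_ne ha h1))
  -- the rational line, its characters and avatars
  obtain ⟨Φ, θS, θQ, m, hmz, b, ψ₁, hfM, hmM, hpM, hcard, hθS, hkerS, hθQ, hkerQ, hprod, hSb, hQb, hψ₁, e⟩ :=
    exists_rationalLineData_of_hss p W hCM h5 hram ψ ω hω hss
  have hcardQ : Nat.card Φ.Quot = p := HerbrandLineRestriction.natCard_quot_eq_of_card_sub W Φ hcard
  have hcontS : ∀ x : Φ.Sub, Continuous fun g : absoluteGaloisGroup ℚ ↦ g • x :=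
    Φ.continuous_smul_sub (LevelDictionary.continuous_smul_geomTorsion W (p : ℤ))
  have hcontQ : ∀ y : Φ.Quot, Continuous fun g : absoluteGaloisGroup ℚ ↦ g • y :=
    Φ.continuous_smul_quot (LevelDictionary.continuous_smul_geomTorsion W (p : ℤ))
  -- a place of `ℚ` above `p`, a prime of `\bar ℤ` above it: non-trivial action and the decomposition witnesses
  obtain ⟨v₀, hv₀⟩ := Literature.NumberTheory.NumberFields.RingOfIntegers.exists_heightOneSpectrum_natCast_mem ℚ hpr
  obtain ⟨𝔓₀, h𝔓₀⟩ := v₀.primesAbove_nonempty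
  obtain ⟨g₀, -, -, c₀, hc₀, hg₀⟩ := BorelTorsion.exists_sq_mem_inertia_homothety (W := W) p hCM h5 hram hv₀ h𝔓₀
  have hntS : ∃ (g : absoluteGaloisGroup ℚ) (x : Φ.Sub), g • x ≠ x := by
    haveI : Finite Φ.Sub := Nat.finite_of_card_ne_zero (by rw [hcard]; exact hpr.ne_zero)
    haveI : Nontrivial Φ.Sub := Finite.one_lt_card_iff_nontrivial.mp (by rw [hcard]; exact hpr.one_lt)
    obtain ⟨x, hx⟩ := exists_ne (0 : Φ.Sub)
    exact ⟨g₀, x, HerbrandInertiaAtP.smul_ne_sub_of_homothety W Φ hcard hc₀ hg₀ hx⟩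
  have hntQ : ∃ (g : absoluteGaloisGroup ℚ) (y : Φ.Quot), g • y ≠ y := by
    haveI : Finite Φ.Quot := Nat.finite_of_card_ne_zero (by rw [hcardQ]; exact hpr.ne_zero)
    haveI : Nontrivial Φ.Quot := Finite.one_lt_card_iff_nontrivial.mp (by rw [hcardQ]; exact hpr.one_lt)
    obtain ⟨y, hy⟩ := exists_ne (0 : Φ.Quot)
    exact ⟨g₀, y, HerbrandInertiaAtP.smul_ne_quot_of_homothety W Φ hcard hc₀ hg₀ hy⟩
  have HS : ∀ (ℓ : HeightOneSpectrum (𝓞 ℚ)), ((p : ℕ) : 𝓞 ℚ) ∈ ℓ.asIdeal → ∀ 𝔓 ∈ ℓ.primesAbove,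
      ∃ g ∈ 𝔓.decompositionSubgroup (absoluteGaloisGroup ℚ), θS g ≠ modNCyclotomicCharacter ℚ p g :=
    fun ℓ hℓ 𝔓 h𝔓 ↦ (exists_mem_decompositionSubgroup_apply_ne_cyclotomic_at_p W Φ hCM h5 hram hcard θS θQ hθS hθQ hprod
      hℓ h𝔓).1
  have HQ : ∀ (ℓ : HeightOneSpectrum (𝓞 ℚ)), ((p : ℕ) : 𝓞 ℚ) ∈ ℓ.asIdeal → ∀ 𝔓 ∈ ℓ.primesAbove,
      ∃ g ∈ 𝔓.decompositionSubgroup (absoluteGaloisGroup ℚ), θQ g ≠ modNCyclotomicCharacter ℚ p g :=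
    fun ℓ hℓ 𝔓 h𝔓 ↦ (exists_mem_decompositionSubgroup_apply_ne_cyclotomic_at_p W Φ hCM h5 hram hcard θS θQ hθS hθQ hprod
      hℓ h𝔓).2
  -- a complex conjugation and the parities of the two characters
  obtain ⟨c, hc⟩ := exists_isComplexConjugation (Rat.castHom ℝ)
  have hmc : modNCyclotomicCharacter ℚ m c = -1 :=
    Units.ext (by rw [Units.val_neg, Units.val_one]; exact modNCyclotomicCharacter_of_isComplexConjugation hc)
  have hpc : modNCyclotomicCharacter ℚ p c = -1 :=
    Units.ext (by rw [Units.val_neg, Units.val_one]; exact modNCyclotomicCharacter_of_isComplexConjugation hc)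
  have hSc : θS c = b (-1) := by rw [hSb c, hmc]
  have hQc : θQ c = -1 * (b (-1))⁻¹ := by rw [hQb c, hpc, hmc]
  have hpar := BernoulliUnits.odd_iff_of_teichmuller_lift hp2 b hψ₁
  -- the avatars: `ψ₁` for `θS`, `λ₃ = ψ₁⁻¹↑·ω↑` (level `m·p`) for `θQ`
  haveI : NeZero (m * p) := ⟨Nat.mul_ne_zero (NeZero.ne m) hpr.ne_zero⟩
  have hlamS : ∀ τ : absoluteGaloisGroup ℚ, ψ₁ ((modNCyclotomicCharacter ℚ m τ : (ZMod m)ˣ) : ZMod m) =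
      (((Kato2004.teichmullerChar p (θS τ) : ℤ_[p]ˣ) : ℤ_[p]) : ℚ_[p]) := fun τ ↦ by rw [hSb τ, hψ₁]
  set lam₃ : DirichletCharacter ℚ_[p] (m * p) := changeLevel (dvd_mul_right m p) ψ₁⁻¹ * changeLevel (dvd_mul_left p m) ω
    with hlam₃
  have el₃ : changeLevel (dvd_refl (m * p)) lam₃ = changeLevel (dvd_mul_right m p) ψ₁⁻¹ * changeLevel (dvd_mul_left p m) ω := by
    rw [hlam₃, changeLevel_self]
  have hlamQ : ∀ τ : absoluteGaloisGroup ℚ, lam₃ ((modNCyclotomicCharacter ℚ (m * p) τ : (ZMod (m * p))ˣ) : ZMod (m * p)) =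
      (((Kato2004.teichmullerChar p (θQ τ) : ℤ_[p]ˣ) : ℤ_[p]) : ℚ_[p]) := fun τ ↦ by
    rw [hQb τ]
    exact (BernoulliUnits.avatar_level_of_lift_psiInvOmega hp2 b hψ₁ hω (dvd_refl (m * p)) (dvd_mul_right m p)
      (dvd_mul_left p m) lam₃ el₃ τ).symm
  -- common-level bookkeeping (`M = f·m·p`)
  have hmpM : m * p ∣ f * m * p := ⟨f, by ring⟩
  have h1M : 1 ∣ f * m * p := one_dvd _
  have hf1M : f * 1 ∣ f * m * p := by rw [mul_one]; exact hfM
  have hL₃ : changeLevel hmpM lam₃ = changeLevel hmM ψ₁⁻¹ * changeLevel hpM ω := by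
    rw [hlam₃, map_mul, ← changeLevel_trans, ← changeLevel_trans]
  -- the Kummer class of `P` and the hypotheses of (α-W)
  obtain ⟨Qt, hQt⟩ := (W.baseChange (AlgebraicClosure ℚ)).zsmul_surjective_of_isAlgClosed hp0 (toGeomPoints W P)
  have hQt : (p : ℤ) • Qt = toGeomPoints W P := hQt
  have hQfix : (p : ℤ) • Qt ∈ MulAction.fixedPoints (absoluteGaloisGroup ℚ) (geomPoints W) := by
    rw [hQt]; exact toGeomPoints_mem_fixedPoints W P
  have hloc : ∀ v : HeightOneSpectrum (𝓞 ℚ), ¬ (W.HasGoodReductionAt v ∧ ((p : ℕ) : 𝓞 ℚ) ∉ v.asIdeal) →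
      kummerClassTorsion W (p : ℤ) Qt hQfix ∈ W.torsionLocalKer (v.adicCompletion ℚ) (p : ℤ) := by
    intro v hv
    by_cases hpv : ((p : ℕ) : 𝓞 ℚ) ∈ v.asIdeal
    · exact LevelDictionary.kummerClassTorsion_mem_torsionLocalKer_of_toPadicPoint_nsmul W v hpv Qt hQfix P hQt hlev
    · have hbad : ¬ W.HasGoodReductionAt v := fun h ↦ hv ⟨h, hpv⟩
      exact W.mem_torsionLocalKer_adicCompletion_of_forall_nsmul_eq_zero (v := v) p hpv
        (forall_prime_nsmul_eq_zero_adicCompletion_of_bad (K := ℚ) W hCM hram h5 hpv hbad) _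
  have hQI : ∀ v : HeightOneSpectrum (𝓞 ℚ), ¬ (W.HasGoodReductionAt v ∧ ((p : ℕ) : 𝓞 ℚ) ∉ v.asIdeal) →
      ∀ 𝔓 ∈ v.primesAbove, ∀ q : Φ.Quot, (∀ g ∈ 𝔓.inertia (absoluteGaloisGroup ℚ), g • q = q) → q = 0 := by
    intro v hv 𝔓 h𝔓 q hq
    by_cases hpv : ((p : ℕ) : 𝓞 ℚ) ∈ v.asIdeal
    · exact quot_eq_zero_of_forall_inertia_smul_eq_at_p W Φ hCM h5 hram hcard hpv h𝔓 q hq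
    · have hbad : ¬ W.HasGoodReductionAt v := fun h ↦ hv ⟨h, hpv⟩
      exact quot_eq_zero_of_forall_inertia_smul_eq_of_bad (K := ℚ) W Φ hCM hram h5 hpv hbad h𝔓 q hq
  -- (α-W): an everywhere-unramified non-zero class for the quotient or for the sub
  -- (the generic lemma carries the classical `DecidableEq` instance on `ℚ`; `convert` bridges the instance)
  have hP' := fun R : W.toAffine.Point ↦ hP R
  rcases LevelDictionary.unramified_quot_or_sub_of_kummer_line W hpr.ne_zero Φ Qt hQfix P hQt
      (fun R ↦ by convert hP' R) hloc hQI with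
    ⟨zq, -, hzq0, hzqI⟩ | ⟨w, -, hw0, hwI, -⟩
  · -- a class for `Φ.Quot`, character `θQ = χ̄_p (b∘χ_m)⁻¹`
    rcases e with e | e
    · -- `ψ ~ ψ₁` (odd): `θQ ~ ψ₁⁻¹ω` is EVEN — the EVEN engine with `λ₃`
      have hψ₁odd : ψ₁.Odd := by
        unfold DirichletCharacter.Odd
        rw [BernoulliUnits.apply_neg_one_eq_of_changeLevel_eq hmM ψ₁ e.symm, EisensteinPair.changeLevel_apply_neg_one]
        exact hψ
      have hb1 : b (-1) = -1 := hpar.1.mp hψ₁odd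
      have hθQc : θQ c = 1 := by rw [hQc, hb1, inv_neg, inv_one, neg_mul_neg, one_mul]
      have hL₃' : changeLevel hmpM lam₃ = changeLevel hfM ψ⁻¹ * changeLevel hpM ω := by
        rw [hL₃, map_inv, map_inv, ← e]
      have heven₃ : lam₃.Even := by
        unfold DirichletCharacter.Even
        rw [BernoulliUnits.apply_neg_one_eq_of_changeLevel_eq hmpM lam₃ hL₃', MulChar.mul_apply, map_inv,
          MulChar.inv_apply_eq_inv', EisensteinPair.changeLevel_apply_neg_one, EisensteinPair.changeLevel_apply_neg_one,
          hψ, hωodd, inv_neg, inv_one, neg_mul_neg, one_mul]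
      have hB₃ : ‖bernoulliOnePrim (changeLevel (dvd_mul_right (m * p) p) lam₃ *
          changeLevel (dvd_mul_left p (m * p)) ω⁻¹)‖ = 1 := by
        rw [BernoulliUnits.bernoulliOnePrim_mul_omegaInv_eq_of_lift_psiInvOmega hmpM hfM h1M hpM hf1M lam₃ ψ
          (1 : DirichletCharacter ℚ_[p] 1) ω hL₃' hψ,
          RegularLocusBernoulliPair.bernoulliOnePrim_bernoulliCharOne_of_not_even ψ _ hne]
        exact hB1
      exact false_of_unramified_class_of_even_avatar hp2 hcardQ hcontQ hntQ θQ hθQ hkerQ zq hzq0 hzqI hc hθQc HQ lam₃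
        hlamQ heven₃ hω hB₃
    · -- `ψ ~ ψ₁⁻¹ω`: `θQ ~ ψ₁⁻¹ω ~ ψ` is ODD — the ODD engine with `λ₃`
      have hL₃' : changeLevel hmpM lam₃ = changeLevel hfM ψ := by rw [hL₃, ← e]
      have hodd₃ : lam₃.Odd := by
        unfold DirichletCharacter.Odd
        rw [BernoulliUnits.apply_neg_one_eq_of_changeLevel_eq hmpM lam₃ hL₃', EisensteinPair.changeLevel_apply_neg_one]
        exact hψ
      have hB₃ : ‖bernoulliOnePrim lam₃⁻¹‖ = 1 := by
        rw [BernoulliUnits.bernoulliOnePrim_inv_eq_of_lift_psi hmpM hfM lam₃ ψ (1 : DirichletCharacter ℚ_[p] 1) hL₃' hψ,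
          RegularLocusBernoulliPair.bernoulliOnePrim_bernoulliCharOne_of_not_even ψ _ hne]
        exact hB1
      exact false_of_unramified_class_of_odd_avatar hp2 hcardQ hcontQ hntQ θQ hθQ hkerQ zq hzq0 hzqI lam₃ hlamQ hodd₃ hB₃
  · -- a class for `Φ.Sub`, character `θS = b∘χ_m`
    rcases e with e | e
    · -- `ψ ~ ψ₁`: `θS ~ ψ₁ ~ ψ` is ODD — the ODD engine with `ψ₁`
      have hψ₁odd : ψ₁.Odd := by
        unfold DirichletCharacter.Odd
        rw [BernoulliUnits.apply_neg_one_eq_of_changeLevel_eq hmM ψ₁ e.symm, EisensteinPair.changeLevel_apply_neg_one]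
        exact hψ
      have hB₁ : ‖bernoulliOnePrim ψ₁⁻¹‖ = 1 := by
        rw [BernoulliUnits.bernoulliOnePrim_inv_eq_of_lift_psi hmM hfM ψ₁ ψ (1 : DirichletCharacter ℚ_[p] 1) e.symm hψ,
          RegularLocusBernoulliPair.bernoulliOnePrim_bernoulliCharOne_of_not_even ψ _ hne]
        exact hB1
      exact false_of_unramified_class_of_odd_avatar hp2 hcard hcontS hntS θS hθS hkerS w hw0 hwI ψ₁ hlamS hψ₁odd hB₁
    · -- `ψ ~ ψ₁⁻¹ω`: `θS ~ ψ₁ ~ ψ⁻¹ω` is EVEN — the EVEN engine with `ψ₁`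
      have hL₁ : changeLevel hmM ψ₁ = changeLevel hfM ψ⁻¹ * changeLevel hpM ω := by
        rw [map_inv, e, map_inv, mul_inv, inv_inv, inv_mul_cancel_right]
      have hψ₁even : ψ₁.Even := by
        unfold DirichletCharacter.Even
        rw [BernoulliUnits.apply_neg_one_eq_of_changeLevel_eq hmM ψ₁ hL₁, MulChar.mul_apply, map_inv,
          MulChar.inv_apply_eq_inv', EisensteinPair.changeLevel_apply_neg_one, EisensteinPair.changeLevel_apply_neg_one,
          hψ, hωodd, inv_neg, inv_one, neg_mul_neg, one_mul]
      have hb1 : b (-1) = 1 := hpar.2.mp hψ₁even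
      have hθSc : θS c = 1 := by rw [hSc, hb1]
      have hB₁ : ‖bernoulliOnePrim (changeLevel (dvd_mul_right m p) ψ₁ * changeLevel (dvd_mul_left p m) ω⁻¹)‖ = 1 := by
        rw [BernoulliUnits.bernoulliOnePrim_mul_omegaInv_eq_of_lift_psiInvOmega hmM hfM h1M hpM hf1M ψ₁ ψ
          (1 : DirichletCharacter ℚ_[p] 1) ω hL₁ hψ,
          RegularLocusBernoulliPair.bernoulliOnePrim_bernoulliCharOne_of_not_even ψ _ hne]
        exact hB1
      exact false_of_unramified_class_of_even_avatar hp2 hcard hcontS hntS θS hθS hkerS w hw0 hwI hc hθSc HS ψ₁ hlamS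
        hψ₁even hω hB₁

omit [W.IsElliptic] [W.IsGloballyMinimal] in
/-- **Not `p`-divisible in `W(ℚ)`, from the crux's generator binders.** If `P` is not of finite order and generates `W(ℚ)`
modulo torsion (`R = kP + T`, `T` torsion, for every `R`), then `pR ≠ P` for every `R ∈ W(ℚ)`. [folklore] -/
theorem forall_zsmul_ne_of_generator (P : W.toAffine.Point) (hPtor : ¬ IsOfFinAddOrder P)
    (hgen : ∀ R : W.toAffine.Point, ∃ (k : ℤ) (T : W.toAffine.Point), IsOfFinAddOrder T ∧ R = k • P + T) :
    ∀ R : W.toAffine.Point, (p : ℤ) • R ≠ P := by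
  intro R hR
  obtain ⟨k, T, hT, hRk⟩ := hgen R
  apply hPtor
  -- `(1 - p k) • P = p • T` is of finite order
  have h1 : (1 - (p : ℤ) * k) • P = (p : ℤ) • T := by
    rw [hRk] at hR
    -- `hR : p • (k • P + T) = P`
    calc (1 - (p : ℤ) * k) • P = P - ((p : ℤ) * k) • P := by module
      _ = (p : ℤ) • (k • P + T) - ((p : ℤ) * k) • P := by nth_rw 1 [← hR]
      _ = (p : ℤ) • T := by module
  have hfin : IsOfFinAddOrder ((1 - (p : ℤ) * k) • P) := by rw [h1]; exact hT.zsmul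
  obtain ⟨n, hn, hnP⟩ := (isOfFinAddOrder_iff_zsmul_eq_zero).1 hfin
  rw [smul_smul] at hnP
  refine (isOfFinAddOrder_iff_zsmul_eq_zero).2 ⟨n * (1 - (p : ℤ) * k), ?_, hnP⟩
  refine mul_ne_zero hn fun h ↦ ?_
  -- `1 = p k` is impossible for a prime `p`
  have h' : (p : ℤ) * k = 1 := by linarith
  have h1' := Int.eq_one_of_mul_eq_one_right (by positivity) h'
  have hp1 : p = 1 := by exact_mod_cast h1'
  exact hp.out.one_lt.ne' hp1

/-- **The (α) consumer in the crux's binder currency: a generator of LEVEL ≥ 1 forces a non-unit class factor.** Same class and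
character datum; `P ∈ W(ℚ)` not torsion and generating `W(ℚ)` modulo torsion (the binders of `X12.O11.RamifiedCMBottomClassIndexLawAtZp`),
with `p • Q = W.toPadicPoint p P` solvable in `W(ℚ_p)`. Then `‖B_{1,ψ⁻¹}‖_p ≤ p⁻¹`.
[cite: SilvermanAEC2009, VIII.§2 and X.§4] [cite: Washington1997, §6.3 and §10.2] -/
theorem norm_bernoulliOnePrim_le_of_level_pos_of_generator (hCM : W.HasCM) (hram : CMRamified W p) (h5 : 5 ≤ p)
    {f : ℕ} [NeZero f] (ψ : DirichletCharacter ℚ_[p] f) (ω : DirichletCharacter ℚ_[p] p)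
    (hψ : ψ.Odd) (hω : IsTeichmullerCharacter ω)
    (hss : ∀ ℓ : ℕ, ℓ.Prime → ¬ (ℓ ∣ p * W.conductorNorm ℤ) →
      ‖((W.LFunction ℓ : ℤ) : ℚ_[p]) - (ψ (ℓ : ZMod f) + ψ⁻¹ (ℓ : ZMod f) * ω (ℓ : ZMod p))‖ < 1)
    (P : W.toAffine.Point) (hPtor : ¬ IsOfFinAddOrder P)
    (hgen : ∀ R : W.toAffine.Point, ∃ (k : ℤ) (T : W.toAffine.Point), IsOfFinAddOrder T ∧ R = k • P + T)
    (hlev : ∃ Q : (W.baseChange ℚ_[p]).toAffine.Point, p • Q = W.toPadicPoint p P) :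
    ‖bernoulliOnePrim ψ⁻¹‖ ≤ (p : ℝ)⁻¹ :=
  norm_bernoulliOnePrim_le_of_level_pos p W hCM hram h5 ψ ω hψ hω hss P (forall_zsmul_ne_of_generator p W P hPtor hgen) hlev

/-- **Contrapositive, in the crux's binder currency: UNIT CLASS FACTOR ⟹ LEVEL `n = 0`.** On the class, for an odd Kriz–Li datum
`(f, ψ, ω)` with `hss` and a UNIT class factor (`¬ ‖B_{1,ψ⁻¹}‖_p ≤ p⁻¹` — the Kriz–Li locus side of registry v18's split), the
generator `P` of `W(ℚ)` modulo torsion has level `n = 0`: if `p^n • Q = W.toPadicPoint p P` is solvable in `W(ℚ_p)` then `n = 0`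
(so the crux's binder `n` vanishes for EVERY model of the class on the locus — «`n = n' = 0` by descent alone», LEAD g10 report
§2(d)(α) COROLLARY). [cite: SilvermanAEC2009, VIII.§2 and X.§4] [cite: KrizLi2019, §1.5 (p. 7)] -/
theorem level_eq_zero_of_unit_classFactor (hCM : W.HasCM) (hram : CMRamified W p) (h5 : 5 ≤ p)
    {f : ℕ} [NeZero f] (ψ : DirichletCharacter ℚ_[p] f) (ω : DirichletCharacter ℚ_[p] p)
    (hψ : ψ.Odd) (hω : IsTeichmullerCharacter ω)
    (hss : ∀ ℓ : ℕ, ℓ.Prime → ¬ (ℓ ∣ p * W.conductorNorm ℤ) →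
      ‖((W.LFunction ℓ : ℤ) : ℚ_[p]) - (ψ (ℓ : ZMod f) + ψ⁻¹ (ℓ : ZMod f) * ω (ℓ : ZMod p))‖ < 1)
    (hunit : ¬ ‖bernoulliOnePrim ψ⁻¹‖ ≤ (p : ℝ)⁻¹)
    (P : W.toAffine.Point) (hPtor : ¬ IsOfFinAddOrder P)
    (hgen : ∀ R : W.toAffine.Point, ∃ (k : ℤ) (T : W.toAffine.Point), IsOfFinAddOrder T ∧ R = k • P + T)
    {n : ℕ} (hn : ∃ Q : (W.baseChange ℚ_[p]).toAffine.Point, p ^ n • Q = W.toPadicPoint p P) : n = 0 := by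
  by_contra hn0
  obtain ⟨k, rfl⟩ := Nat.exists_eq_succ_of_ne_zero hn0
  obtain ⟨Q, hQ⟩ := hn
  refine hunit (norm_bernoulliOnePrim_le_of_level_pos_of_generator p W hCM hram h5 ψ ω hψ hω hss P hPtor hgen
    ⟨p ^ k • Q, ?_⟩)
  rw [← mul_smul, ← pow_succ', hQ]

/-- **(append) B1's premise from the crux's own level binder `n ≥ 1`** — the form LEAD g11 quotes for the planner's B1 item
(STATUS 22:11:05Z (3)): on the class, for the odd Kriz–Li datum `(f, ψ, ω)` with `hss`, the crux's generator `P` (non-torsion,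
generating `W(ℚ)` modulo torsion) and its level binder `∃ Q : W(ℚ_[p]), p ^ n • Q = W.toPadicPoint p P` with **`1 ≤ n`**:
`‖B_{1,ψ⁻¹}‖_p ≤ p⁻¹`. (`p^n • Q = p • (p^{n−1} • Q)`.) [cite: SilvermanAEC2009, VIII.§2 and X.§4] [cite: KrizLi2019, §1.5 (p. 7)] -/
theorem norm_bernoulliOnePrim_le_of_one_le_level (hCM : W.HasCM) (hram : CMRamified W p) (h5 : 5 ≤ p)
    {f : ℕ} [NeZero f] (ψ : DirichletCharacter ℚ_[p] f) (ω : DirichletCharacter ℚ_[p] p)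
    (hψ : ψ.Odd) (hω : IsTeichmullerCharacter ω)
    (hss : ∀ ℓ : ℕ, ℓ.Prime → ¬ (ℓ ∣ p * W.conductorNorm ℤ) →
      ‖((W.LFunction ℓ : ℤ) : ℚ_[p]) - (ψ (ℓ : ZMod f) + ψ⁻¹ (ℓ : ZMod f) * ω (ℓ : ZMod p))‖ < 1)
    (P : W.toAffine.Point) (hPtor : ¬ IsOfFinAddOrder P)
    (hgen : ∀ R : W.toAffine.Point, ∃ (k : ℤ) (T : W.toAffine.Point), IsOfFinAddOrder T ∧ R = k • P + T)
    {n : ℕ} (hn1 : 1 ≤ n) (hn : ∃ Q : (W.baseChange ℚ_[p]).toAffine.Point, p ^ n • Q = W.toPadicPoint p P) :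
    ‖bernoulliOnePrim ψ⁻¹‖ ≤ (p : ℝ)⁻¹ := by
  by_contra hunit
  have h0 := level_eq_zero_of_unit_classFactor p W hCM hram h5 ψ ω hψ hω hss hunit P hPtor hgen hn
  omega

end Consumer


end Summit.BirchSwinnertonDyer.BirchSwinnertonDyer.Theorems.PrintCFram.LevelDictionaryAlpha

end
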